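import Mathlib
import HarnessLib
import Summits.NavierStokesRegularity.NavierStokesRegularity.Theorems.ChiralWindowDoorDefs

/-!
# Door S21-C «CriticalFluxDoor» (nsreg-p1 ROUND-20, design-only) — the typed substrate

Door S21-C of nsreg-p1's local Type-I door family (`HOME/ns-regularity-ideate-p1/ROUND-20.md`, texts
`r20/Sketch21v3.lean`; DESIGN-ONLY, route NOT born): local Type I at `(x₀,T)` + fading of the scale-normalised local
`Ḣ^{1/2}`-FLUX DENSITY `Φ(u) = ⟪Λu, (u·∇)u⟫` on one similarity window ⇒ regular, PROVIDED flux-free Type-I ancient mild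
profiles are not backward-singular.  This file fixes the door's four notions ONCE in the tree, texts of
`r20/Sketch21v3.lean` VERBATIM over S20's substrate `…ChiralWindowDoorDefs` (`fracLapHalf = Λ`, `gagliardo`, `bumpSq`):

* `fluxDensity u x = ⟪Λu(x), Du(x)[u(x)]⟫`, `IsFluxFree u`;
* `critEnergy a f = ∫ a ⟪f, Λf⟫` (windowed critical energy), `pderiv i f x = Df(x) eᵢ`.

Only unfolding lemmas are proved here; the door's stubs live in `CriticalFluxDoor*` theorem files
(`…CriticalFluxDoorFluxSpread.fluxSpread_of_class` = `stub_fluxSpread` δ-unfolded, nsreg-p6 g12; F1 `critEnergyLower`,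
nsreg-p1 g18, landed as `…CriticalFluxDoorCritEnergyLower`).  `lean search` 2026-08-27: no `fluxDensity`/`critEnergy` on
`EuclideanSpace ℝ (Fin 3)` in `Literature`/`Summits`.

Seat nsreg-p6 g12 (THEOREMS-ONLY door sequels, DIRECTOR-NS g8 #32 (2)/#36); texts by nsreg-p1 g17/g18.  WHAT THIS IS
NOT: not NS regularity (Clay A); vocabulary only; no route is opened.
-/

noncomputable section

-- the summit and its single sub-problem share the name (CONVENTIONS §1), as in every Theorems file
set_option linter.dupNamespace false

namespace Summit.NavierStokesRegularity.NavierStokesRegularity.Theorems.CriticalFluxDoorDefs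

open MeasureTheory Set
open scoped RealInnerProductSpace
open Literature.Analysis Literature.Analysis.FluidPDE
open Summit.NavierStokesRegularity.NavierStokesRegularity.Theorems.ChiralWindowDoorDefs

/-- The LOCAL `Ḣ^{1/2}`-FLUX DENSITY `Φ(u)(x) = ⟪Λu(x), (u·∇)u(x)⟫` (`(u·∇)u(x) = Du(x)[u(x)]`); scale dimension `−5`.
Text of nsreg-p1 `r20/Sketch21v3.lean`, verbatim. -/
def fluxDensity (u : EuclideanSpace ℝ (Fin 3) → EuclideanSpace ℝ (Fin 3)) (x : EuclideanSpace ℝ (Fin 3)) : ℝ :=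
  inner ℝ (Summit.NavierStokesRegularity.NavierStokesRegularity.Theorems.ChiralWindowDoorDefs.fracLapHalf u x) (fderiv ℝ u x (u x))

/-- FLUX-FREE slice: `Φ(u) ≡ 0`.  Text of `r20/Sketch21v3.lean`, verbatim. -/
def IsFluxFree (u : EuclideanSpace ℝ (Fin 3) → EuclideanSpace ℝ (Fin 3)) : Prop := ∀ x, fluxDensity u x = 0

/-- WINDOWED CRITICAL ENERGY `Q(a,f) = ∫ a ⟪f, Λf⟫`.  Text of `r20/Sketch21v3.lean`, verbatim. -/
def critEnergy (a : EuclideanSpace ℝ (Fin 3) → ℝ) (f : EuclideanSpace ℝ (Fin 3) → EuclideanSpace ℝ (Fin 3)) : ℝ :=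
  ∫ x, a x * inner ℝ (f x) (fracLapHalf f x)

/-- Partial derivative of a vector field along the `i`-th coordinate axis.  Text of `r20/Sketch21v3.lean`, verbatim. -/
def pderiv (i : Fin 3) (f : EuclideanSpace ℝ (Fin 3) → EuclideanSpace ℝ (Fin 3)) (x : EuclideanSpace ℝ (Fin 3)) :
    EuclideanSpace ℝ (Fin 3) :=
  fderiv ℝ f x (EuclideanSpace.single i 1)

/-- Unfolding `fluxDensity`. -/
theorem fluxDensity_eq (u : EuclideanSpace ℝ (Fin 3) → EuclideanSpace ℝ (Fin 3)) (x : EuclideanSpace ℝ (Fin 3)) :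
    fluxDensity u x = ⟪fracLapHalf u x, fderiv ℝ u x (u x)⟫ := rfl

/-- Unfolding `IsFluxFree`. -/
theorem isFluxFree_iff (u : EuclideanSpace ℝ (Fin 3) → EuclideanSpace ℝ (Fin 3)) :
    IsFluxFree u ↔ ∀ x, ⟪fracLapHalf u x, fderiv ℝ u x (u x)⟫ = 0 := Iff.rfl

/-- Unfolding `critEnergy`. -/
theorem critEnergy_eq (a : EuclideanSpace ℝ (Fin 3) → ℝ) (f : EuclideanSpace ℝ (Fin 3) → EuclideanSpace ℝ (Fin 3)) :
    critEnergy a f = ∫ x, a x * ⟪f x, fracLapHalf f x⟫ := rfl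

/-- Unfolding `pderiv`. -/
theorem pderiv_eq (i : Fin 3) (f : EuclideanSpace ℝ (Fin 3) → EuclideanSpace ℝ (Fin 3)) (x : EuclideanSpace ℝ (Fin 3)) :
    pderiv i f x = fderiv ℝ f x (EuclideanSpace.single i 1) := rfl

/-- The flux density of the zero field vanishes. -/
theorem fluxDensity_zero (x : EuclideanSpace ℝ (Fin 3)) :
    fluxDensity (fun _ => (0 : EuclideanSpace ℝ (Fin 3))) x = 0 := by
  simp [fluxDensity]

/-! ### Technical constants and majorants of the `Λ`-calculus (F2/F3 bookkeeping; nsreg-p1 g17 `r20/LambdaDecay.lean`)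

Appended by nsreg-p6 g13 so that the proof files `CriticalFluxDoorLambda{Decay,Deriv,Symmetry}` / `…PressureIBP` /
`…CritEnergy*` stay definition-free: the universal constant of the weighted `Λ`-decay lemma, the radial cut-off profile of
its cross terms, the `x`-uniform majorant of the derivative integrand, and the commutator `[Λ,a]v`. -/

/-- The universal constant of the weighted `Λ`-decay lemma (`…CriticalFluxDoorLambdaDecay.norm_fracLapHalf_le_weighted`):
`24|B₁|/π²`. -/
def lamDecayConst : ℝ :=
  24 * (volume : Measure (EuclideanSpace ℝ (Fin 3))).real (Metric.ball 0 1) / Real.pi ^ 2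

/-- `0 ≤ 24|B₁|/π²`. -/
theorem lamDecayConst_nonneg : 0 ≤ lamDecayConst := by
  unfold lamDecayConst
  exact div_nonneg (mul_nonneg (by norm_num) measureReal_nonneg) (by positivity)

/-- The radial cut-off profile of the cross terms of the weighted `Λ`-decay lemma: `k(w) = (‖w‖+a)⁻¹` on `B_L(0)`, `0`
outside. -/
def kfun (L a : ℝ) : EuclideanSpace ℝ (Fin 3) → ℝ :=
  (Metric.ball (0 : EuclideanSpace ℝ (Fin 3)) L).indicator fun w => (‖w‖ + a)⁻¹

/-- `k ≥ 0` for `a > 0`. -/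
theorem kfun_nonneg {L a : ℝ} (ha : 0 < a) (w : EuclideanSpace ℝ (Fin 3)) : 0 ≤ kfun L a w := by
  unfold kfun; by_cases hw : w ∈ Metric.ball (0 : EuclideanSpace ℝ (Fin 3)) L
  · rw [indicator_of_mem hw]; positivity
  · rw [indicator_of_notMem hw]

/-- `k` is even. -/
theorem kfun_neg (L a : ℝ) (w : EuclideanSpace ℝ (Fin 3)) : kfun L a (-w) = kfun L a w := by
  unfold kfun
  by_cases hw : w ∈ Metric.ball (0 : EuclideanSpace ℝ (Fin 3)) L
  · have hw' : -w ∈ Metric.ball (0 : EuclideanSpace ℝ (Fin 3)) L := by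
      rwa [mem_ball_zero_iff, norm_neg, ← mem_ball_zero_iff]
    rw [indicator_of_mem hw, indicator_of_mem hw', norm_neg]
  · have hw' : -w ∉ Metric.ball (0 : EuclideanSpace ℝ (Fin 3)) L := by
      rwa [mem_ball_zero_iff, norm_neg, ← mem_ball_zero_iff]
    rw [indicator_of_notMem hw, indicator_of_notMem hw']

/-- The `x`-uniform integrable majorant of the kernel integrand `K(z)‖2g(x) − g(x+z) − g(x−z)‖` of a `C²` field with
`‖g‖ ≤ M₁`, `‖D²g‖ ≤ M₃`: `π⁻²·2M₃‖z‖⁻²` on `B₁`, `π⁻²·4M₁‖z‖⁻⁴` off `B₁`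
(`…CriticalFluxDoorLambdaDeriv.norm_integrand_le_derivDom`). -/
def derivDom (M₁ M₃ : ℝ) (z : EuclideanSpace ℝ (Fin 3)) : ℝ :=
  (Metric.ball (0 : EuclideanSpace ℝ (Fin 3)) 1).indicator (fun z => (1 / Real.pi ^ 2 * (2 * M₃)) * ‖z‖ ^ (-(2 : ℝ))) z +
  (Metric.ball (0 : EuclideanSpace ℝ (Fin 3)) 1)ᶜ.indicator (fun z => (1 / Real.pi ^ 2 * (4 * M₁)) * ‖z‖ ^ (-(4 : ℝ))) z

/-- THE COMMUTATOR `[Λ,a]v(x) = ½∫K(z)[(a(x)−a(x+z))v(x+z) + (a(x)−a(x−z))v(x−z)]dz` of `Λ` with the multiplication by a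
scalar weight `a` (F3-DERIVATION §1; `Λ(a v) = aΛv + [Λ,a]v` is `…CriticalFluxDoorLambdaSymmetry.fracLapHalf_smul_eq`). -/
def lamComm (a : EuclideanSpace ℝ (Fin 3) → ℝ) (v : EuclideanSpace ℝ (Fin 3) → EuclideanSpace ℝ (Fin 3))
    (x : EuclideanSpace ℝ (Fin 3)) : EuclideanSpace ℝ (Fin 3) :=
  (1 / 2 : ℝ) • ∫ z, lamK z • ((a x - a (x + z)) • v (x + z) + (a x - a (x - z)) • v (x - z))

/-- Unfolding `lamComm`. -/
theorem lamComm_eq (a : EuclideanSpace ℝ (Fin 3) → ℝ) (v : EuclideanSpace ℝ (Fin 3) → EuclideanSpace ℝ (Fin 3))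
    (x : EuclideanSpace ℝ (Fin 3)) :
    lamComm a v x = (1 / 2 : ℝ) • ∫ z, lamK z • ((a x - a (x + z)) • v (x + z) + (a x - a (x - z)) • v (x - z)) := rfl

end Summit.NavierStokesRegularity.NavierStokesRegularity.Theorems.CriticalFluxDoorDefs

end
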